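import Literature.MathematicalPhysics.QuantumFieldTheory.Balaban1983to89.B15HDecayLeaves
import Literature.MathematicalPhysics.QuantumFieldTheory.Balaban1983to89.B15Ineq146Proof

/-!
# `Balaban1983to89.B15Ineq146From190` — [Balaban1989LargeFieldI] (1.45)–(1.46) p. 186: the SECOND printed inequality of
# (1.46) END-TO-END from [15] (190) — r12's `B15HDecayLeaves.ineq145_of_ineq190` ((1.45) from (190)) composed with p29's
# `B15Ineq146Proof.ineq146_of_145` ((1.45) ⇒ (1.46) on the `ℤ^d` lattice carriers)

statement-level skeleton of published theorems with citation tags; proofs where landed; nothing here is a claim about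
the Yang–Mills mass gap.

CITATION HEADER (lean-in-tree rule 2026-08-18).  T. Bałaban, *Large field renormalization. I. The basic step of the 𝐑
operation*, Commun. Math. Phys. **122**, 175–202 (1989), doi:10.1007/BF01257412, bib `Balaban1989LargeFieldI` (cell
paper B15; PDF held `paper:balaban1989-cmp122-large-field-i`; p. 186 = PDF 12).  "[15]" = [Balaban1985Variational] (190)
p. 308 (`B11SectG.Ineq190`); "[3]" = [Balaban1984PropagatorsII] (2.61) p. 234 (`B11SectG.RowSum`).  WHAT IS REPRODUCED:
SKELETON rows `B15.Eq1.45`/`B15.Eq1.46`, unit `lit-balaban-r12` gen 8 (reader/typer and fold owner of block B15), HOME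
`run/shared/lean/pub/lit-balaban/` (`lit-balaban-r12/ROWS-B15.md`).  Used BY NAME, nothing restated:
`B15HDecayLeaves.ineq145_of_ineq190` (r12), `B15Ineq146Proof.ineq146_of_145` (p29), the typed leaf
`B15.PrelimIntegrations.Ineq146`.

THE PRINTED TEXT (p. 186, verbatim): *"The field in the argument of the function ℍ^{(n)}_k is bounded by 4δ′_j, and is
localized in the domain Ω^c_{j+1}∖Z″_{j+1}, therefore the following estimate holds: [(1.45)]. … Using the representation
(1.44), and the above estimate, we obtain [(1.46)]"*.

WHAT IS PROVED (0 `sorry`, no `def`, no new `Prop`).  `ineq146_of_ineq190` — the typed leaf `Ineq146 |U(∂p) − 1| |U₀(∂p) − 1|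
B₃ L^{−i} δ dist δ′_j ratio β₀ gap (ε_iL^{−2i})` for the lattice plaquette variables of `U = (e^{iηℍ}U₀)^{u⁻¹}` ((1.44)) with
`B₃ = Cκ_Bc` and `δ = τ`, from: (190) for the two sizes of (1.45) at every base point, (2.61), the B-size bound `4δ′_j` and
localisation of the argument field, the mean-value domination (inputs of `ineq145_of_ineq190`); the DICTIONARY between the
block sizes and the lattice field (`hdom₀`: the size `bout₀.loc y ℍB` dominates `L^iη|ℍ(b)|` at the four bonds of `∂p`,
`hdom₁`: `bout₁.loc y ℍB` dominates `(L^iη)²|∇^η_{U₀}ℍ|` at the two covariant derivatives — print's *"sup_{B^i(y)}"* with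
`p ∈ B^i(y)`); and p29's located inputs (`128B₃δ′_j ≤ 1`, `δ′_j ≤ ratio·ε_j`, the flow factor, signs).
HONEST SCOPE.  A composition; the dictionary hypotheses identify the abstract block sizes of [15]'s vocabulary with the
sups over `B^i(y)` of the lattice field.  NOT summit progress.
-/

namespace Literature.MathematicalPhysics.QuantumFieldTheory.Balaban1983to89.B15Ineq146From190

open Literature.MathematicalPhysics.QuantumFieldTheory.Balaban1983to89
open B11SectG B7Prop1Explicit B15.PrelimIntegrations B15HDecayLeaves B15Ineq146Proof

/-- **(1.46), second inequality, FROM (190)** (composition `ineq146_of_145 ∘ ineq145_of_ineq190`). [cite: Balaban1989LargeFieldI, (1.45)–(1.46) p.186; Balaban1985Variational, (190) p.308] -/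
theorem ineq146_of_ineq190
    -- [15]'s block-majorant data for (1.45)
    {gB : B6.Geometry} {FB FA : Type} [AddCommGroup FB] [Module ℝ FB] [AddCommGroup FA] [Module ℝ FA]
    {T : Type*} {bB : BlockNorm gB FB} {bout₀ bout₁ : BlockNorm gB FA} {dH : T → FB →ₗ[ℝ] FA}
    {C δ₀ σ τ c δ'j dist : ℝ}
    (h190₀ : ∀ t, Ineq190 bB bout₀ (dH t) C δ₀) (h190₁ : ∀ t, Ineq190 bB bout₁ (dH t) C δ₀) (hC : 0 ≤ C)
    (hd : ∀ a b : gB.Site, 0 ≤ gB.dist a b) (hrow : RowSum gB σ c) (hτ : 0 ≤ τ) (hστ : σ + τ ≤ δ₀ / 8)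
    (B : FB) (hm : ∀ y', bB.loc y' B ≤ 4 * δ'j) (y : gB.Site) (hD : ∀ y', bB.loc y' B ≠ 0 → dist ≤ gB.dist y y')
    {HB : FA} (hmv₀ : ∀ s : ℝ, (∀ t, bout₀.loc y (dH t B) ≤ s) → bout₀.loc y HB ≤ s)
    (hmv₁ : ∀ s : ℝ, (∀ t, bout₁.loc y (dH t B) ≤ s) → bout₁.loc y HB ≤ s)
    -- the lattice data of (1.44)/(1.46)
    {d : ℕ} {𝔸 : Type*} [CStarAlgebra 𝔸] [Nontrivial 𝔸]
    {η : ℝ} (hη : 0 < η) {U₀ : B7Prop1Explicit.Site d → Fin d → 𝔸ˣ} (h₀ : ∀ z κ, U₀ z κ ∈ U1 𝔸)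
    {H : B7Prop1Explicit.Site d → Fin d → 𝔸} (hH : ∀ z κ, IsSelfAdjoint (H z κ))
    {g : B7Prop1Explicit.Site d → 𝔸ˣ} (hg : ∀ z, g z ∈ U1 𝔸) (μ ν : Fin d) (x : B7Prop1Explicit.Site d)
    {ratio β₀ gap εi εj Linv Lpow : ℝ}
    -- the dictionary: the block sizes dominate the weighted lattice values at the bonds / derivatives of `∂p ⊂ B^i(y)`
    (hdom₁ : Lpow * η * ‖H x μ‖ ≤ bout₀.loc y HB) (hdom₂ : Lpow * η * ‖H (x + e μ) ν‖ ≤ bout₀.loc y HB)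
    (hdom₃ : Lpow * η * ‖H (x + e ν) μ‖ ≤ bout₀.loc y HB) (hdom₄ : Lpow * η * ‖H x ν‖ ≤ bout₀.loc y HB)
    (hdomD₁ : (Lpow * η) ^ 2 * ‖B8Ineq132.covDerivFwd η U₀ μ (fun z => H z ν) x‖ ≤ bout₁.loc y HB)
    (hdomD₂ : (Lpow * η) ^ 2 * ‖B8Ineq132.covDerivFwd η U₀ ν (fun z => H z μ) x‖ ≤ bout₁.loc y HB)
    -- p29's located inputs
    (hL : Lpow * Linv = 1) (hLinv : 0 ≤ Linv) (hc : 0 ≤ c) (hδ'j : 0 ≤ δ'j) (hdist : 0 ≤ τ * dist)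
    (hsmall : 128 * (C * bB.κ * c) * δ'j ≤ 1) (hratio : 0 ≤ ratio) (hδ'ε : δ'j ≤ ratio * εj)
    (hflow : εj ≤ (1 + β₀) * (1 + gap ^ (1 / 2 : ℝ)) * εi) :
    Ineq146 ‖B8Ineq132.plaqF (gaugeAct g (B8Lemma1NonAbelian.mulCfg (B8Eq146AExpansion.expCfg
        (B8Eq146AExpansion.iEta η H)) U₀)) μ ν x - 1‖ ‖B8Ineq132.plaqF U₀ μ ν x - 1‖
      (C * bB.κ * c) Linv τ dist δ'j ratio β₀ gap (εi * Linv ^ 2) := by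
  have h145 := ineq145_of_ineq190 h190₀ h190₁ hC hd hrow hτ hστ B hm y hD hmv₀ hmv₁
  have hB₃ : 0 ≤ C * bB.κ * c := mul_nonneg (mul_nonneg hC bB.κ_nonneg) hc
  exact ineq146_of_145 hη h₀ hH hg μ ν x h145 hdom₁ hdom₂ hdom₃ hdom₄ hdomD₁ hdomD₂ hL hLinv hB₃ hδ'j hdist hsmall
    hratio hδ'ε hflow

end Literature.MathematicalPhysics.QuantumFieldTheory.Balaban1983to89.B15Ineq146From190
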